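import Summits.BirchSwinnertonDyer.BirchSwinnertonDyer.Theorems.EisensteinPrimesFSideCorankLe
import HarnessLib

/-!
# The `f`-side `S`-relaxation `≤` WITHOUT `p ∤ N`: `corank_{ℤ_p}(Sel_𝔭^{Sf}/Sel_𝔭^∅)(E_K[p^∞]/K_∞) ≤
# Σ_{w∈Sf} λ(𝒫_w(f))` for `Sf` ANY finite set of places of `K` lying over `N_E` and NOT over `p` —
# the shape needed at an Eisenstein prime `p ‖ N` (crux 4 `BSDpOnCellC`, Keller–Yin §5.1: `S = Σ ∖ {v, v̄, ∞}`)

Cell `bsd-eis` (home `run/shared/lean/pub/bsd-eis/`), seat `bsd-line-x2-p2` (D-0154 KEY row 5, width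
gen 3) on crux 4 `BSDpOnCellC` (stmt-BirchSwinnertonDyer-19034), line b1. Seat `bsd-line-x1-p1-w2`'s
`FSideCorankLe.zpCorank_selmerAc_quotient_le_sum_curveLocalLambda` (p618030; crux 2, good `p`) takes
`Sf` = ALL places of `K` over `N_E` and the hypothesis `¬ p ∣ N_E`, used at exactly one point: to know
that no `w ∈ Sf` lies over `p`. At a multiplicative Eisenstein prime `p ‖ N` (crux 4; Keller–Yin
arXiv:2402.12781v2 §5.1, where the imprimitive set is `S = Σ ∖ {v, v̄, ∞}`, the primes over `N` MINUS
the two primes over `p`) that hypothesis fails but its use does not: one simply takes `Sf` = the places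
over `N_E` that are not over `p`. This file re-runs the assembly with the two membership consequences
(`N_E ∈ w`, `p ∉ w` for `w ∈ Sf`) as the hypotheses, so that ONE statement serves both cruxes:

* §1 `zpCorank_selmerAc_quotient_le_sum_of_loc_offP` — `SelmerAcQuotientCorankOfLoc.…_of_loc`
  (p612280) with `hSf : w ∈ Sf ↔ N ∈ w` + `p ∤ N` replaced by `∀ w ∈ Sf, N ∈ w` and `∀ w ∈ Sf, p ∉ w`
  (ANY elliptic `W/K`, any per-place bounds `c_w`).
* §2 `zpCorank_selmerAc_quotient_le_sum_curveLocalLambda_offP` — the final sum for `E ×_ℚ K`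
  (`c_w = rootMultiplicity((Nw)⁻¹, P̃_w(E_K))`: additive `0`, split multiplicative p613424, non-split
  p617025), same two hypotheses, NO `p ∤ N_E`, any odd `p`.
* §3 `zpCorank_selmerAc_quotient_le_sum_curveLocalLambda_of_offP_iff` — the crux-4 shape: `Sf`
  characterised by `w ∈ Sf ↔ (N_E ∈ w ∧ p ∉ w)`; and `…_of_not_dvd` — p618030's statement recovered
  (`Sf` = all places over `N_E`, `p ∤ N_E`), so nothing is lost.

HONEST FRAMING: tool theorems (no definition, no named fact, no `sorry`); ONE direction (`≤`) of the
`f`-side `S`-relaxation identity (Keller–Yin Rem. 1.4.2 / CGLS (eq:1)); the `≥` direction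
(Pollack–Weston A.2) is not claimed; helper `--supports stmt-BirchSwinnertonDyer-19034`; closes no stub;
BSD / Mazur's MC / the anticyclotomic IMC is proved for no curve; no summit statement is proved here.

References: Keller–Yin arXiv:2402.12781v2 §5.1 (L1725–1735: `S = Σ ∖ {v, v̄, ∞}`), Rem. 1.4.2, §1.5;
CGLS 2022 (eq:1), L893–901; Greenberg–Vatsal 2000 §2 Prop. (2.4), Cor. (2.3); Castella 2018 Def. 2.2;
Brink 2007 Thm. 2; Silverman ATAEC V.5.3.
-/

-- `Summit.BirchSwinnertonDyer.BirchSwinnertonDyer.…`: summit and sub-problem share a name (D-0017 layout).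
set_option linter.dupNamespace false
set_option autoImplicit false

noncomputable section

open scoped Classical AddSubgroup

open CategoryTheory Function NumberField IsDedekindDomain Field ValuativeRel Polynomial
open Literature.NumberTheory.EllipticCurves Literature.NumberTheory.EllipticCurves.GreenbergSelmer
  Literature.NumberTheory.EllipticCurves.Castella2018 Literature.NumberTheory.QuadraticFields
  Literature.NumberTheory.EllipticCurves.Rank1Residual
  Literature.NumberTheory.EllipticCurves.GreenbergVatsal2000
  Literature.NumberTheory.EllipticCurves.KellerYin2024
  Literature.NumberTheory.GaloisRepresentations Literature.NumberTheory.DiophantineGeometry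
  Literature.NumberTheory.GaloisRepresentations.IsNonarchimedeanLocalField
  IsDedekindDomain.HeightOneSpectrum Rat.HeightOneSpectrum
  Summit.BirchSwinnertonDyer.Rank1Residual Summit.BirchSwinnertonDyer.Rank1Residual.X2
  Summit.BirchSwinnertonDyer.Rank1Residual.X2.NonPrimitiveQuotientCorank
  Summit.BirchSwinnertonDyer.BirchSwinnertonDyer.Theorems
  Summit.BirchSwinnertonDyer.BirchSwinnertonDyer.Theorems.SelmerAcQuotientCorankLeCurveLocalLambda
open WeierstrassCurve (geomTorsion)
open Literature.NumberTheory.EllipticCurves.KellerYin2024 (curveLocalLambda numPlacesAbove)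

namespace Summit.BirchSwinnertonDyer.BirchSwinnertonDyer.Theorems.FSideCorankLeOffP

variable {K : Type} [Field K] [NumberField K] {p : ℕ} [hp : Fact p.Prime]

/-! ## §1 The generic assembly, off-`p` places over `N` -/

/-- **`zpCorank (Sel_𝔭^{Sf}(K_∞, E[p^∞]) / Sel_𝔭(K_∞, E[p^∞])) p ≤ Σ_{w∈Sf} [Γ : Γ_w] · c_w`, for `Sf`
any finite set of places of `K` over `N` and off `p`.** `K` imaginary quadratic, `2 < p`, (Heeg) for
`N`, `κ` anticyclotomic with topological generator `γ`, ANY elliptic `W/K`, any `𝔭`; hypotheses on `Sf`: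
`∀ w ∈ Sf, N ∈ w` (so `w` is split over `ℚ` and finitely decomposed in `K_∞`, Brink) and
`∀ w ∈ Sf, p ∉ w` (so `I_w ≤ ker κ`); `hloc` = per-place bounds `c_w` on the subgroups of the image of
the inertia restriction. Proof = p612280's, whose `p ∤ N` served only to derive `p ∉ w`.
[cite: CastellaGrossiLeeSkinner2022, proof of Thm. 1.5.1 (arXiv:2008.02571v2 TeX L909–931)]
[cite: KellerYin2024, §5.1 (arXiv:2402.12781v2 L1725–1735: `S = Σ ∖ {v, v̄, ∞}`)]
[cite: Castella2018, Def. 2.2 (arXiv:1704.06608 p. 5)] [cite: Brink2007, Thm. 2] -/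
theorem zpCorank_selmerAc_quotient_le_sum_of_loc_offP (hK : IsImaginaryQuadratic K) (hp2 : 2 < p)
    {N : ℕ} (hH : SatisfiesHeegnerHypothesis N K) (κ : ZpExtension K p)
    (hκ : κ.IsAnticyclotomic) {γ : absoluteGaloisGroup K} (hγ : κ.IsTopGenerator γ)
    (W : WeierstrassCurve K) [W.IsElliptic] (𝔭 : HeightOneSpectrum (𝓞 K))
    (Sf : Finset (HeightOneSpectrum (𝓞 K)))
    (hSfN : ∀ w ∈ Sf, ((N : ℤ) : 𝓞 K) ∈ w.asIdeal)
    (hSfp : ∀ w ∈ Sf, ((p : ℕ) : 𝓞 K) ∉ w.asIdeal)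
    (c : HeightOneSpectrum (𝓞 K) → ℕ)
    (hloc : ∀ w ∈ Sf, ∀ Y : AddSubgroup (discreteH1 (inertiaIn κ.kerSubgroup w) (W.geomPrimaryTorsion p)),
      (∀ y ∈ Y, ∃ x : subgroupH1 κ.kerSubgroup (W.geomPrimaryTorsion p),
        resH1Hom (inertiaInToH κ.kerSubgroup w) (AddMonoidHom.id (W.geomPrimaryTorsion p))
          (fun _ _ ↦ rfl) x = y) →
      zpCorank Y p ≤ c w) :
    zpCorank (↥(AcSelmer.selmerAc W p κ 𝔭 (↑Sf : Set (HeightOneSpectrum (𝓞 K)))) ⧸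
      (AcSelmer.selmerAc W p κ 𝔭 (∅ : Set (HeightOneSpectrum (𝓞 K)))).addSubgroupOf
        (AcSelmer.selmerAc W p κ 𝔭 (↑Sf : Set (HeightOneSpectrum (𝓞 K))))) p ≤
      ∑ w ∈ Sf, numPlacesAbove κ w * c w := by
  -- module facts of `M = E[p^∞]`
  have htor : ∀ m : W.geomPrimaryTorsion p, ∃ k : ℕ, p ^ k • m = 0 :=
    X2.LocalInertiaCohomologyMultiplicative.primary_curve W p
  have hdiv : ∀ m : W.geomPrimaryTorsion p, ∃ m' : W.geomPrimaryTorsion p, p • m' = m :=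
    X2.GreenbergVatsalTorsionCurve.divisible_curve W p
  have hstab : ∀ m : W.geomPrimaryTorsion p,
      IsOpen (MulAction.stabilizer (absoluteGaloisGroup K) m : Set (absoluteGaloisGroup K)) :=
    fun m ↦ X11b.LocBridge.isOpen_stabilizer_geomPrimaryTorsion W p m
  haveI : Finite ↥((W.geomPrimaryTorsion p)[(p : ℤ)]) :=
    X2.LocalInertiaCohomologyMultiplicative.finite_torsionBy_curve W p
  have hcard : ∃ k : ℕ, Nat.card ↥((W.geomPrimaryTorsion p)[(p : ℤ)]) = p ^ k :=
    ⟨2, X2.LocalInertiaCohomologyMultiplicative.natCard_torsionBy_curve W p⟩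
  -- the places in `Sf`: over `N` (hence finitely decomposed), off `p` (hence unramified in `K_∞`)
  have hD : ∀ w ∈ Sf, ∃ δ ∈ decomp (K := K) w, κ δ ≠ 1 := fun w hw ↦
    UnrSelmerQuotientTorsionFiniteChar.exists_mem_decomp_apply_ne_one_of_heegner hK hp2 hH κ hκ w
      (by exact_mod_cast hSfN w hw) (hSfp w hw)
  have hUT : ∀ w ∈ Sf, unramifiedKer κ.kerSubgroup (W.geomPrimaryTorsion p) w ≤
      awayKer κ.kerSubgroup (W.geomPrimaryTorsion p) w := by
    intro w hw
    obtain ⟨δ, hδ, hne⟩ := hD w hw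
    exact UnramifiedLeAwayKer.unramifiedKer_le_awayKer_of_not_decomp_le κ hstab htor
      (Iwasawa.inertia_le_kerSubgroup' κ w (hSfp w hw))
      (fun hle ↦ hne (ZpExtension.mem_kerSubgroup.mp (hle hδ)))
  exact SelmerAcQuotientCorankLeGeneric.zpCorank_selmerOver_quotient_le_sum κ
    (M := W.geomPrimaryTorsion p) htor hcard hdiv hstab 𝔭 Sf hSfp (fun w ↦ numPlacesAbove κ w) c
    (fun w hw σ ↦ NumPlacesAboveRepresentatives.forall_exists_lt_numPlacesAbove κ w hγ (hD w hw) σ)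
    hloc hUT

/-! ## §2 The final sum for `E ×_ℚ K`, any odd `p`, `Sf` over `N_E` and off `p` -/

/-- **The `f`-side `≤`-half, FINAL SUM, without `p ∤ N_E`.**  For a globally minimal elliptic `E/ℚ`,
an odd prime `p` (good OR bad for `E`), `K` imaginary quadratic with the Heegner hypothesis for `N_E`,
an anticyclotomic `ℤ_p`-extension `κ` with topological generator `γ`, any `𝔭`, and `Sf` any finite
set of places of `K` each lying over `N_E` and not over `p`:
`corank_{ℤ_p}(Sel_𝔭^{Sf}(E_K/K_∞) / Sel_𝔭(E_K/K_∞)) ≤ Σ_{w∈Sf} curveLocalLambda κ E_K w`.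
Proof = p618030's line by line (§1 with `c_w = rootMultiplicity((Nw)⁻¹, P̃_w(E_K))`; at `w ∈ Sf` the
prime `ℓ` below `w` divides `N_E`; additive ⇒ `0` (p612280 §2); split multiplicative ⇒ p613424;
non-split ⇒ p617025), the only change being that `p ∉ w` is now a hypothesis, not a consequence of
`p ∤ N_E`. At `p ‖ N_E` this is the `f`-side `S`-relaxation inequality for Keller–Yin's
`S = Σ ∖ {v, v̄, ∞}` (§5.1). [cite: GreenbergVatsal2000, §2 Prop. (2.4) pp. 22–23 and Cor. (2.3)]
[cite: KellerYin2024, §5.1 (arXiv:2402.12781v2 L1725–1735) and Rem. 1.4.2 (L1130–1140)]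
[cite: CastellaGrossiLeeSkinner2022, (eq:1) (arXiv:2008.02571v2 TeX L882–884), L893–901 (𝒫_w(E))]
[cite: SilvermanATAEC1994, Ch. V Lemma 5.2 (c), Thm. 5.3 (a),(b), Cor. 5.4] -/
theorem zpCorank_selmerAc_quotient_le_sum_curveLocalLambda_offP
    (W : WeierstrassCurve ℚ) [W.IsElliptic] [W.IsGloballyMinimal]
    (hp2 : 2 < p) (hK : IsImaginaryQuadratic K) (hH : SatisfiesHeegnerHypothesis (W.conductorNorm ℤ) K)
    (κ : ZpExtension K p) (hκ : κ.IsAnticyclotomic) {γ : absoluteGaloisGroup K}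
    (hγ : κ.IsTopGenerator γ) (𝔭 : HeightOneSpectrum (𝓞 K)) (Sf : Finset (HeightOneSpectrum (𝓞 K)))
    (hSfN : ∀ w ∈ Sf, ((W.conductorNorm ℤ : ℤ) : 𝓞 K) ∈ w.asIdeal)
    (hSfp : ∀ w ∈ Sf, ((p : ℕ) : 𝓞 K) ∉ w.asIdeal) :
    zpCorank (↥(AcSelmer.selmerAc (W.baseChange K) p κ 𝔭 (↑Sf : Set (HeightOneSpectrum (𝓞 K)))) ⧸
        (AcSelmer.selmerAc (W.baseChange K) p κ 𝔭 (∅ : Set (HeightOneSpectrum (𝓞 K)))).addSubgroupOf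
          (AcSelmer.selmerAc (W.baseChange K) p κ 𝔭 (↑Sf : Set (HeightOneSpectrum (𝓞 K))))) p ≤
      ∑ w ∈ Sf, curveLocalLambda κ (W.baseChange K) w := by
  haveI : (W.baseChange K).IsElliptic := by rw [WeierstrassCurve.baseChange]; infer_instance
  have hT : Silverman1994_thmV53_tateUniformisation.{0} :=
    TateCurve.Silverman1994_thmV53_tateUniformisation_holds
  have hp2' : p ≠ 2 := by omega
  refine zpCorank_selmerAc_quotient_le_sum_of_loc_offP hK hp2 hH κ hκ hγ (W.baseChange K) 𝔭 Sf
    (fun w hw ↦ by exact_mod_cast hSfN w hw) hSfp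
    (fun w ↦ (GreenbergVatsal2000.eulerFactorModP (W.baseChange K) p w).rootMultiplicity
      ((w.asIdeal.absNorm : ZMod p)⁻¹)) ?_
  intro w hw Y hY
  -- the place `w ∋ N_E`, off `p`; the prime `ℓ = Nw` below it
  have hwN : ((W.conductorNorm ℤ : ℤ) : 𝓞 K) ∈ w.asIdeal := hSfN w hw
  have hpw : ((p : ℕ) : 𝓞 K) ∉ w.asIdeal := hSfp w hw
  set u := w.under (𝓞 ℚ) with hu
  set ℓ := natGenerator u with hℓ
  have hℓN : ℓ ∣ W.conductorNorm ℤ := natGenerator_under_dvd_of_mem w hwN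
  have hbad : ¬ W.HasGoodReductionAt u := (W.dvd_conductorNorm_iff u).mp hℓN
  by_cases hadd : W.HasAdditiveReductionAt u
  · -- additive at `ℓ`: `E_K` additive at `w`, the local group is finite
    have haddK : (W.baseChange K).HasAdditiveReductionAt w :=
      hasAdditiveReductionAt_baseChange_of_heegner W hK hH w hwN hadd
    rw [SelmerAcQuotientCorankOfLoc.zpCorank_eq_zero_of_hasAdditiveReductionAt (W.baseChange K)
      κ.kerSubgroup w hpw haddK (Iwasawa.inertia_le_kerSubgroup' κ w hpw) Y]
    exact Nat.zero_le _
  · -- multiplicative at `ℓ`, hence `E_K` multiplicative at `w`; split on `E_K`'s own type at `w`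
    have hmultK : (W.baseChange K).HasMultiplicativeReductionAt w :=
      hasMultiplicativeReductionAt_baseChange_of_heegner W hK hH w hwN hbad hadd
    have hD := UnrSelmerQuotientTorsionFiniteChar.exists_mem_decomp_apply_ne_one_of_heegner hK hp2 hH κ
      hκ w hwN hpw
    have hpos : 0 < numPlacesAbove κ w :=
      NumPlacesAboveRepresentatives.numPlacesAbove_pos κ w hD
    by_cases hsplitK : (W.baseChange K).HasSplitMultiplicativeReductionAt w
    · have hb := SelmerAcSplitMultiplicativePlace.zpCorank_le_of_hasSplitMultiplicativeReductionAt hT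
        (W.baseChange K) hp2' κ hpw hsplitK Y hY
      have hR := SelmerAcSplitMultiplicativePlace.curveLocalLambda_of_hasSplitMultiplicativeReductionAt
        (p := p) κ (W.baseChange K) hsplitK
      rw [KellerYin2024.curveLocalLambda_eq] at hR
      rw [Nat.eq_of_mul_eq_mul_left hpos hR]
      exact hb
    · have hb := SqrtGammaNonsplitFrobenius.zpCorank_le_of_not_hasSplitMultiplicativeReductionAt
        (W.baseChange K) hp2' κ hpw hmultK hsplitK Y hY
      have hR := SelmerAcMultiplicativePlaceSign.curveLocalLambda_of_not_hasSplitMultiplicativeReductionAt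
        (p := p) κ (W.baseChange K) hmultK hsplitK
      rw [KellerYin2024.curveLocalLambda_eq] at hR
      rw [Nat.eq_of_mul_eq_mul_left hpos hR]
      exact hb

/-! ## §3 The two shapes in use: crux 4 (`p ‖ N`, `Sf` over `N` off `p`) and crux 2 (`p ∤ N`) -/

/-- **The crux-4 shape (`p ‖ N_E` allowed): `Sf` = the places of `K` over `N_E` NOT over `p`**, i.e.
`w ∈ Sf ↔ (N_E ∈ w ∧ p ∉ w)` — Keller–Yin's `S = Σ ∖ {v, v̄, ∞}` at a multiplicative Eisenstein prime.
`corank_{ℤ_p}(Sel_𝔭^{Sf}/Sel_𝔭^∅)(E_K/K_∞) ≤ Σ_{w∈Sf} curveLocalLambda κ E_K w`, any odd `p`.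
[cite: KellerYin2024, §5.1 (arXiv:2402.12781v2 L1725–1735)] [cite: GreenbergVatsal2000, §2 Prop. (2.4)] -/
theorem zpCorank_selmerAc_quotient_le_sum_curveLocalLambda_of_offP_iff
    (W : WeierstrassCurve ℚ) [W.IsElliptic] [W.IsGloballyMinimal]
    (hp2 : 2 < p) (hK : IsImaginaryQuadratic K) (hH : SatisfiesHeegnerHypothesis (W.conductorNorm ℤ) K)
    (κ : ZpExtension K p) (hκ : κ.IsAnticyclotomic) {γ : absoluteGaloisGroup K}
    (hγ : κ.IsTopGenerator γ) (𝔭 : HeightOneSpectrum (𝓞 K)) (Sf : Finset (HeightOneSpectrum (𝓞 K)))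
    (hSf : ∀ w : HeightOneSpectrum (𝓞 K), w ∈ Sf ↔
      (((W.conductorNorm ℤ : ℤ) : 𝓞 K) ∈ w.asIdeal ∧ ((p : ℕ) : 𝓞 K) ∉ w.asIdeal)) :
    zpCorank (↥(AcSelmer.selmerAc (W.baseChange K) p κ 𝔭 (↑Sf : Set (HeightOneSpectrum (𝓞 K)))) ⧸
        (AcSelmer.selmerAc (W.baseChange K) p κ 𝔭 (∅ : Set (HeightOneSpectrum (𝓞 K)))).addSubgroupOf
          (AcSelmer.selmerAc (W.baseChange K) p κ 𝔭 (↑Sf : Set (HeightOneSpectrum (𝓞 K))))) p ≤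
      ∑ w ∈ Sf, curveLocalLambda κ (W.baseChange K) w :=
  zpCorank_selmerAc_quotient_le_sum_curveLocalLambda_offP W hp2 hK hH κ hκ hγ 𝔭 Sf
    (fun w hw ↦ ((hSf w).mp hw).1) (fun w hw ↦ ((hSf w).mp hw).2)

/-- **The crux-2 shape recovered (`p ∤ N_E`, `Sf` = ALL places over `N_E`)** — the statement of
`FSideCorankLe.zpCorank_selmerAc_quotient_le_sum_curveLocalLambda` (p618030) as a special case of §2:
`p ∤ N_E` and `N_E ∈ w` give `p ∉ w` (`N_E` and `p` are coprime, so `1 ∈ w` otherwise).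
[cite: KellerYin2024, Rem. 1.4.2 (arXiv:2402.12781v2 TeX L1130–1140)] [cite: GreenbergVatsal2000, §2 Prop. (2.4)] -/
theorem zpCorank_selmerAc_quotient_le_sum_curveLocalLambda_of_not_dvd
    (W : WeierstrassCurve ℚ) [W.IsElliptic] [W.IsGloballyMinimal]
    (hp2 : 2 < p) (hpN : ¬ p ∣ W.conductorNorm ℤ)
    (hK : IsImaginaryQuadratic K) (hH : SatisfiesHeegnerHypothesis (W.conductorNorm ℤ) K)
    (κ : ZpExtension K p) (hκ : κ.IsAnticyclotomic) {γ : absoluteGaloisGroup K}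
    (hγ : κ.IsTopGenerator γ) (𝔭 : HeightOneSpectrum (𝓞 K)) (Sf : Finset (HeightOneSpectrum (𝓞 K)))
    (hSf : ∀ w : HeightOneSpectrum (𝓞 K), w ∈ Sf ↔ ((W.conductorNorm ℤ : ℤ) : 𝓞 K) ∈ w.asIdeal) :
    zpCorank (↥(AcSelmer.selmerAc (W.baseChange K) p κ 𝔭 (↑Sf : Set (HeightOneSpectrum (𝓞 K)))) ⧸
        (AcSelmer.selmerAc (W.baseChange K) p κ 𝔭 (∅ : Set (HeightOneSpectrum (𝓞 K)))).addSubgroupOf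
          (AcSelmer.selmerAc (W.baseChange K) p κ 𝔭 (↑Sf : Set (HeightOneSpectrum (𝓞 K))))) p ≤
      ∑ w ∈ Sf, curveLocalLambda κ (W.baseChange K) w := by
  refine zpCorank_selmerAc_quotient_le_sum_curveLocalLambda_offP W hp2 hK hH κ hκ hγ 𝔭 Sf
    (fun w hw ↦ (hSf w).mp hw) (fun w hw hpw ↦ ?_)
  have hwN : ((W.conductorNorm ℤ : ℕ) : 𝓞 K) ∈ w.asIdeal := by exact_mod_cast (hSf w).mp hw
  have hcop : IsCoprime (W.conductorNorm ℤ : ℤ) (p : ℤ) :=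
    Nat.isCoprime_iff_coprime.mpr
      (Nat.Coprime.symm ((Nat.Prime.coprime_iff_not_dvd hp.out).mpr hpN))
  obtain ⟨a, b, hab⟩ := hcop
  have h1 : (1 : 𝓞 K) ∈ w.asIdeal := by
    have e := congrArg (fun z : ℤ ↦ (z : 𝓞 K)) hab
    push_cast at e
    rw [← e]
    exact w.asIdeal.add_mem (w.asIdeal.mul_mem_left _ hwN) (w.asIdeal.mul_mem_left _ hpw)
  exact w.isPrime.ne_top ((Ideal.eq_top_iff_one _).mpr h1)

end Summit.BirchSwinnertonDyer.BirchSwinnertonDyer.Theorems.FSideCorankLeOffP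

end
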